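import Literature.Probability.LatticeModels.ReflectedCurrents
import Literature.Probability.LatticeModels.InfraredBoundProofs
import HarnessLib

/-!
# The reflections of an even discrete torus are fold data
# (Duminil-Copin–Panis 2025, §2.2, transported to `(ℤ/Lℤ)^d`)

Topic `Literature/Probability/LatticeModels`; family `crit-ising`. Second layer (after
`ReflectedCurrents.lean`: the abstract fold datum `IsFoldable G θ Λ H₋` and the switching lemma for
reflected currents, Duminil-Copin–Panis, CMP 406 (2025), arXiv:2404.05700, Lemma 2.3) of the tree's
route to **Theorem 1.2** of that paper at `β_c` (the named fact
`Literature.Probability.LatticeModels.dcp_reflectedGradient_lower`, `CriticalTwoPointDCPLower.lean`).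

Why the torus. The printed proof (§2.2) uses, inside ONE random-current configuration, the `2d`
reflections `𝓡_n(±e_i)` through the faces `ℍ_n(±e_i) = {x_i = ±n}` of the box `Λ_n` (the random set
`𝒮_n = ⋂_i (𝒮_n(+e_i) ∩ 𝒮_n(-e_i))`, the union bound of Lemma 2.4 and the symmetry step
"using the symmetries of `𝐏^∅_β`"), and the switching lemma for reflected currents needs a volume
symmetric under the reflection at hand (Lemma 2.3: "`Λ` finite and symmetric under `𝓡_n`"). No finite
`Λ ⊂ ℤ^d` is symmetric under two parallel reflections (they generate a translation), so the source works
with the infinite-volume sourceless current `𝐏^∅_β`. The tree instead runs the finite-volume argument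
on the discrete tori `(ℤ/Lℤ)^d`, `L` even and large, where ALL the reflections `x_i ↦ 2k - x_i` are
simultaneously graph automorphisms, and passes to `L → ∞` afterwards (`TorusTwoPointLimit.lean`:
`μ_{𝕋_L} → μ^∅_β` on pairs when `m*(β) = 0`). This file supplies the required fold data.

## Contents (`namespace Torus`, torus `TorusSite d L = (ZMod L)^d`, `torusGraph d L`, `L` even)

* `Torus.foldCoord i k x = (x_i - k + L/2).val` — the coordinate along which the reflection
  `reflectThroughSites i k : x_i ↦ 2k - x_i` (`ReflectionPositivity.lean`) folds: `0` and `L/2` on the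
  two fixed hyperplanes `x_i = k + L/2`, `x_i = k`, in `(0, L/2)` strictly on the side `x_i < k`
  (`Torus.leftSites i k`) and in `(L/2, L)` on the side `x_i > k` (`Torus.rightSites i k`);
  `foldCoord_reflect` (`t ↦ L - t`), `reflect_eq_self_iff`, `foldCoord_of_adj`;
* **`Torus.isFoldable_leftSites` / `Torus.isFoldable_rightSites`**: for `L` even, `L > 2`,
  `IsFoldable (torusGraph d L) (reflectThroughSites i k) univ (leftSites i k)` and the same with the
  right half — the hypotheses of `IsFoldable.tsum_switch_reflected` (Lemma 2.3) and of the finite-volume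
  Lemmas 2.4–2.5 built on it;
* the box `Λ_m ⊂ ℤ^d` seen in the torus (`Torus.proj`, for `4m + 2 ≤ L` and a face `|n| ≤ m`):
  `proj_mem_leftSites_iff` (`x̄ ∈ leftSites i n ↔ x_i < n`), `proj_mem_rightSites_iff`
  (`x̄ ∈ rightSites i n ↔ n < x_i`), `reflect_proj_eq_self_iff` (`x̄` is fixed iff `x_i = n`: the far
  hyperplane misses the box), and `reflectThroughSites_intCast_proj`: the torus reflection through
  `x_i = n` is the projection of the lattice reflection `y_i ↦ 2n - y_i` (`𝓡_n`, `dcpReflect`).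

No named fact; definitions with bodies (`foldCoord`, `leftSites`, `rightSites`) only.

## References

* H. Duminil-Copin, R. Panis, *New lower bounds for the (near) critical Ising and φ⁴ models’ two-point
  functions*, Comm. Math. Phys. 406 (2025), arXiv:2404.05700, §1.1 (`ℍ_n`, `𝓡_n`, `Λ_n`) and §2.2
  [DuminilCopinPanis2025LowerBounds] (held: `lit read arxiv:2404.05700`).
* M. Biskup, *Reflection positivity and phase transitions in lattice spin models*, LNM 1970 (2009),
  §5.1 (reflections of the torus through sites) [Biskup2009] — through `ReflectionPositivity.lean` /
  `InfraredBoundProofs.lean` (`torusGraph_adj_reflectThroughSites`).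
-/

noncomputable section

open Finset

namespace Literature.Probability.LatticeModels

namespace Torus

variable {d L : ℕ} [NeZero L]

/-- **The fold coordinate** of a site for the reflection through the sites `x_i = k`:
`(x_i - k + L/2).val ∈ {0, …, L-1}`. For even `L` it vanishes on the far fixed hyperplane
`x_i = k + L/2`, equals `L/2` on the hyperplane `x_i = k`, lies in `(0, L/2)` strictly on one side
("left", `x_i < k`) and in `(L/2, L)` strictly on the other. [folklore] -/
def foldCoord (i : Fin d) (k : ZMod L) (x : TorusSite d L) : ℕ := (x i - k + ((L / 2 : ℕ) : ZMod L)).val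

/-- **The strict left half** of the torus for the reflection through `x_i = k`: the sites strictly
between the hyperplanes `x_i = k - L/2` and `x_i = k` (fold coordinate in `(0, L/2)`); for a box
`Λ_n` of `ℤ^d` projected to a torus of side `L > 4n` and `k = n` it contains the points of the box
with `x_i < n` (Duminil-Copin–Panis 2025, §2.2: "strictly on the left of `ℍ_n`"). [cite: DuminilCopinPanis2025LowerBounds, §2.2] -/
def leftSites (i : Fin d) (k : ZMod L) : Finset (TorusSite d L) :=
  univ.filter fun x => 0 < foldCoord i k x ∧ foldCoord i k x < L / 2

/-- **The strict right half** (fold coordinate in `(L/2, L)`): the sites with "`x_i > k`" up to the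
far hyperplane. [cite: DuminilCopinPanis2025LowerBounds, §2.2] -/
def rightSites (i : Fin d) (k : ZMod L) : Finset (TorusSite d L) :=
  univ.filter fun x => L / 2 < foldCoord i k x

/-- Membership in the strict left half. [folklore] -/
theorem mem_leftSites {i : Fin d} {k : ZMod L} {x : TorusSite d L} :
    x ∈ leftSites i k ↔ 0 < foldCoord i k x ∧ foldCoord i k x < L / 2 := by
  simp [leftSites]

/-- Membership in the strict right half. [folklore] -/
theorem mem_rightSites {i : Fin d} {k : ZMod L} {x : TorusSite d L} :
    x ∈ rightSites i k ↔ L / 2 < foldCoord i k x := by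
  simp [rightSites]

/-- The fold coordinate is `< L`. [folklore] -/
theorem foldCoord_lt (i : Fin d) (k : ZMod L) (x : TorusSite d L) : foldCoord i k x < L := ZMod.val_lt _

omit [NeZero L] in
/-- For even `L`, `L/2 + L/2 = 0` in `ZMod L`. [folklore] -/
theorem half_add_half (hL : Even L) : (((L / 2 : ℕ) : ZMod L)) + ((L / 2 : ℕ) : ZMod L) = 0 := by
  obtain ⟨M, hM⟩ := hL
  rw [← Nat.cast_add, show L / 2 + L / 2 = L by omega, ZMod.natCast_self]

/-- **The fold coordinate of the reflected site**: `t(θx) = (-t(x)) mod L`, i.e. `0 ↦ 0` and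
`t ↦ L - t` otherwise. [folklore] -/
theorem foldCoord_reflect (hL : Even L) (i : Fin d) (k : ZMod L) (x : TorusSite d L) :
    foldCoord i k (reflectThroughSites i k x) =
      if foldCoord i k x = 0 then 0 else L - foldCoord i k x := by
  unfold foldCoord
  have hkey : reflectThroughSites i k x i - k + ((L / 2 : ℕ) : ZMod L) =
      -(x i - k + ((L / 2 : ℕ) : ZMod L)) := by
    rw [reflectThroughSites_apply, Function.update_self]
    have h2 := half_add_half hL
    linear_combination h2
  rw [hkey, ZMod.neg_val]
  by_cases h0 : x i - k + ((L / 2 : ℕ) : ZMod L) = 0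
  · rw [if_pos h0, h0, ZMod.val_zero, if_pos rfl]
  · rw [if_neg h0, if_neg ((ZMod.val_ne_zero _).2 h0)]

/-- A site is fixed by the reflection iff its fold coordinate is `0` or `L/2`. [folklore] -/
theorem reflect_eq_self_iff (hL : Even L) (i : Fin d) (k : ZMod L) (x : TorusSite d L) :
    reflectThroughSites i k x = x ↔ foldCoord i k x = 0 ∨ foldCoord i k x = L / 2 := by
  have hinj : ∀ y : TorusSite d L, reflectThroughSites i k y = y ↔
      foldCoord i k (reflectThroughSites i k y) = foldCoord i k y := by
    intro y
    constructor
    · intro h; rw [h]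
    · intro h
      unfold foldCoord at h
      have h' := ZMod.val_injective L h
      have h'' : reflectThroughSites i k y i = y i := by
        have := congrArg (fun z => z + k - ((L / 2 : ℕ) : ZMod L)) h'
        simpa using this
      funext j
      by_cases hj : j = i
      · subst hj; exact h''
      · rw [reflectThroughSites_apply, Function.update_of_ne hj]
  rw [hinj, foldCoord_reflect hL]
  have hlt := foldCoord_lt i k x
  have hL0 : L ≠ 0 := NeZero.ne L
  obtain ⟨M, hM⟩ := hL
  constructor
  · intro h
    by_cases h0 : foldCoord i k x = 0
    · exact Or.inl h0
    · rw [if_neg h0] at h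
      right; omega
  · rintro (h0 | hh)
    · rw [if_pos h0, h0]
    · rw [hh, if_neg (by omega)]
      omega


omit [NeZero L] in
/-- Coordinates of adjacent torus sites: `y_i = x_i`, `y_i = x_i + 1` or `x_i = y_i + 1`. [folklore] -/
theorem coord_of_adj {x y : TorusSite d L} (h : (torusGraph d L).Adj x y) (i : Fin d) :
    y i = x i ∨ y i = x i + 1 ∨ x i = y i + 1 := by
  obtain ⟨-, ⟨j, hj⟩ | ⟨j, hj⟩⟩ := (torusGraph_adj_iff x y).1 h
  · rw [hj, Pi.add_apply]
    by_cases hij : i = j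
    · subst hij; simp
    · simp [Pi.single_eq_of_ne hij]
  · rw [hj, Pi.add_apply]
    by_cases hij : i = j
    · subst hij; simp
    · simp [Pi.single_eq_of_ne hij]

/-- `(w + 1).val` in `ZMod L`, `L ≥ 2`: `w.val + 1`, or `0` when `w.val = L - 1`. [folklore] -/
theorem val_add_one_cases (h2 : 2 ≤ L) (w : ZMod L) :
    (w + 1).val = w.val + 1 ∨ (w.val + 1 = L ∧ (w + 1).val = 0) := by
  have h1 : (1 : ZMod L).val = 1 := by
    rw [ZMod.val_one_eq_one_mod, Nat.mod_eq_of_lt (by omega)]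
  have hlt := ZMod.val_lt w
  rw [ZMod.val_add, h1]
  by_cases h : w.val + 1 < L
  · exact Or.inl (Nat.mod_eq_of_lt h)
  · right
    have heq : w.val + 1 = L := by omega
    exact ⟨heq, by rw [heq, Nat.mod_self]⟩

/-- **Fold coordinates of neighbours**: they coincide or differ by one, up to the wrap-around
`L - 1 ↔ 0`. [folklore] -/
theorem foldCoord_of_adj (h2 : 2 ≤ L) (i : Fin d) (k : ZMod L) {x y : TorusSite d L}
    (h : (torusGraph d L).Adj x y) :
    foldCoord i k y = foldCoord i k x ∨
      (foldCoord i k y = foldCoord i k x + 1 ∨ (foldCoord i k x + 1 = L ∧ foldCoord i k y = 0)) ∨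
      (foldCoord i k x = foldCoord i k y + 1 ∨ (foldCoord i k y + 1 = L ∧ foldCoord i k x = 0)) := by
  unfold foldCoord
  rcases coord_of_adj h i with hc | hc | hc
  · exact Or.inl (by rw [hc])
  · right; left
    have : y i - k + ((L / 2 : ℕ) : ZMod L) = (x i - k + ((L / 2 : ℕ) : ZMod L)) + 1 := by rw [hc]; ring
    rw [this]
    exact val_add_one_cases h2 _
  · right; right
    have : x i - k + ((L / 2 : ℕ) : ZMod L) = (y i - k + ((L / 2 : ℕ) : ZMod L)) + 1 := by rw [hc]; ring
    rw [this]
    exact val_add_one_cases h2 _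

/-- **The torus reflection through sites is a fold datum with the strict left half**
(Duminil-Copin–Panis 2025, §2.2, transported to the even torus: every reflection `x_i ↦ 2k - x_i`
of `(ℤ/Lℤ)^d`, `L` even, is an involutive automorphism whose fixed set — the two hyperplanes
`x_i = k`, `x_i = k + L/2` — separates the torus into two halves exchanged by it, with no edge
between the halves). [cite: DuminilCopinPanis2025LowerBounds, §2.2] -/
theorem isFoldable_leftSites (hL : Even L) (h2 : 2 < L) (i : Fin d) (k : ZMod L) :
    IsFoldable (torusGraph d L) (reflectThroughSites i k) univ (leftSites i k) where
  invol := reflectThroughSites_involutive i k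
  adj_iff x y := by
    refine ⟨fun h => ?_, torusGraph_adj_reflectThroughSites i k⟩
    have := torusGraph_adj_reflectThroughSites i k h
    rwa [reflectThroughSites_involutive i k x, reflectThroughSites_involutive i k y] at this
  mem_iff x := by simp
  left_subset := subset_univ _
  left_disjoint x hx := by
    rw [mem_leftSites] at hx ⊢
    rw [foldCoord_reflect hL]
    obtain ⟨M, hM⟩ := hL
    rw [if_neg (by omega)]
    omega
  cover x _ hx := by
    rw [Ne, reflect_eq_self_iff hL] at hx
    push Not at hx
    have hlt := foldCoord_lt i k x
    by_cases hlt' : foldCoord i k x < L / 2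
    · exact Or.inl (mem_leftSites.2 ⟨Nat.pos_of_ne_zero hx.1, hlt'⟩)
    · refine Or.inr (mem_leftSites.2 ?_)
      rw [foldCoord_reflect hL, if_neg hx.1]
      obtain ⟨M, hM⟩ := hL
      omega
  no_cross x hx y hxy hy := by
    rw [mem_leftSites] at hx hy
    rw [foldCoord_reflect hL] at hy
    -- the fold coordinates of neighbours differ by at most one, without wrap-around
    have hstep := foldCoord_of_adj (by omega) i k hxy
    obtain ⟨M, hM⟩ := hL
    split_ifs at hy with h0 <;> omega

/-- **The same fold datum with the strict right half** (the reflected datum: `θ` exchanges the two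
strict halves). [cite: DuminilCopinPanis2025LowerBounds, §2.2] -/
theorem isFoldable_rightSites (hL : Even L) (h2 : 2 < L) (i : Fin d) (k : ZMod L) :
    IsFoldable (torusGraph d L) (reflectThroughSites i k) univ (rightSites i k) where
  invol := reflectThroughSites_involutive i k
  adj_iff x y := by
    refine ⟨fun h => ?_, torusGraph_adj_reflectThroughSites i k⟩
    have := torusGraph_adj_reflectThroughSites i k h
    rwa [reflectThroughSites_involutive i k x, reflectThroughSites_involutive i k y] at this
  mem_iff x := by simp
  left_subset := subset_univ _
  left_disjoint x hx := by
    rw [mem_rightSites] at hx ⊢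
    rw [foldCoord_reflect hL]
    have hlt := foldCoord_lt i k x
    obtain ⟨M, hM⟩ := hL
    rw [if_neg (by omega)]
    omega
  cover x _ hx := by
    rw [Ne, reflect_eq_self_iff hL] at hx
    push Not at hx
    have hlt := foldCoord_lt i k x
    by_cases hlt' : L / 2 < foldCoord i k x
    · exact Or.inl (mem_rightSites.2 hlt')
    · refine Or.inr (mem_rightSites.2 ?_)
      rw [foldCoord_reflect hL, if_neg hx.1]
      obtain ⟨M, hM⟩ := hL
      omega
  no_cross x hx y hxy hy := by
    rw [mem_rightSites] at hx hy
    rw [foldCoord_reflect hL] at hy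
    have hstep := foldCoord_of_adj (by omega) i k hxy
    have hltx := foldCoord_lt i k x
    have hlty := foldCoord_lt i k y
    obtain ⟨M, hM⟩ := hL
    split_ifs at hy with h0 <;> omega

/-! ### Boxes of `ℤ^d` inside the torus -/

/-- The value of a small nonnegative integer cast to `ZMod L`. [folklore] -/
theorem val_intCast_of_nonneg_of_lt {z : ℤ} (h0 : 0 ≤ z) (hz : z < L) : ((z : ZMod L)).val = z.toNat := by
  have h := ZMod.val_intCast (n := L) z
  rw [Int.emod_eq_of_lt h0 hz] at h
  omega

/-- **The fold coordinate of a projected site** for the hyperplane `x_i = c`, `c ∈ ℤ`: if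
`0 ≤ x_i - c + L/2 < L` then it is the natural number `x_i - c + L/2`. [folklore] -/
theorem foldCoord_proj (i : Fin d) (c : ℤ) (x : Site d) (h0 : 0 ≤ x i - c + ((L / 2 : ℕ) : ℤ))
    (hlt : x i - c + ((L / 2 : ℕ) : ℤ) < L) :
    foldCoord i ((c : ℤ) : ZMod L) (Torus.proj L x) = (x i - c + ((L / 2 : ℕ) : ℤ)).toNat := by
  unfold foldCoord
  have hcast : (((x i - c + ((L / 2 : ℕ) : ℤ) : ℤ)) : ZMod L) =
      ((x i : ℤ) : ZMod L) - ((c : ℤ) : ZMod L) + ((L / 2 : ℕ) : ZMod L) := by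
    rw [Int.cast_add, Int.cast_sub, Int.cast_natCast]
  rw [Torus.proj_apply, ← hcast]
  exact val_intCast_of_nonneg_of_lt h0 hlt

/-- **Box points and the left half of the hyperplane `x_i = n`**: for `x ∈ Λ_m` and `4m + 2 ≤ L`
(`L` even), `x̄ ∈ leftSites i n ↔ x_i < n` whenever `|n| ≤ m`. [cite: DuminilCopinPanis2025LowerBounds, §2.2] -/
theorem proj_mem_leftSites_iff (hL : Even L) (i : Fin d) {m : ℕ} {n : ℤ} (hn : |n| ≤ m) (hmL : 4 * m + 2 ≤ L)
    {x : Site d} (hx : x ∈ box d m) :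
    Torus.proj L x ∈ leftSites i ((n : ℤ) : ZMod L) ↔ x i < n := by
  have hxi := mem_box.1 hx i
  rw [abs_le] at hn
  obtain ⟨M, hM⟩ := hL
  rw [mem_leftSites, foldCoord_proj i n x (by push_cast; omega) (by push_cast; omega)]
  push_cast
  omega

/-- Box points are never in the far right half of `x_i = n` beyond… precisely: for `x ∈ Λ_m`,
`4m + 2 ≤ L`, `|n| ≤ m`: `x̄ ∈ rightSites i n ↔ n < x_i`. [cite: DuminilCopinPanis2025LowerBounds, §2.2] -/
theorem proj_mem_rightSites_iff (hL : Even L) (i : Fin d) {m : ℕ} {n : ℤ} (hn : |n| ≤ m) (hmL : 4 * m + 2 ≤ L)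
    {x : Site d} (hx : x ∈ box d m) :
    Torus.proj L x ∈ rightSites i ((n : ℤ) : ZMod L) ↔ n < x i := by
  have hxi := mem_box.1 hx i
  rw [abs_le] at hn
  obtain ⟨M, hM⟩ := hL
  rw [mem_rightSites, foldCoord_proj i n x (by push_cast; omega) (by push_cast; omega)]
  push_cast
  omega

/-- **Box points fixed by the reflection through `x_i = n`** are exactly those with `x_i = n`
(for `x ∈ Λ_m`, `|n| ≤ m`, `4m + 2 ≤ L`: the far hyperplane `x_i = n + L/2` misses the box). [cite: DuminilCopinPanis2025LowerBounds, §2.2] -/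
theorem reflect_proj_eq_self_iff (hL : Even L) (i : Fin d) {m : ℕ} {n : ℤ} (hn : |n| ≤ m) (hmL : 4 * m + 2 ≤ L)
    {x : Site d} (hx : x ∈ box d m) :
    reflectThroughSites i ((n : ℤ) : ZMod L) (Torus.proj L x) = Torus.proj L x ↔ x i = n := by
  have hxi := mem_box.1 hx i
  rw [abs_le] at hn
  have hL' := hL
  obtain ⟨M, hM⟩ := hL
  rw [reflect_eq_self_iff hL', foldCoord_proj i n x (by push_cast; omega) (by push_cast; omega)]
  push_cast
  omega

omit [NeZero L] in
/-- The torus reflection through `x_i = n` is the projection of the lattice reflection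
`y_i ↦ 2n - y_i` (the `𝓡_n` of Duminil-Copin–Panis 2025, §1.1, along the axis `i`). [cite: DuminilCopinPanis2025LowerBounds, §1.1 (definition of 𝓡_n)] -/
theorem reflectThroughSites_intCast_proj (i : Fin d) (n : ℤ) (x : Site d) :
    reflectThroughSites i ((n : ℤ) : ZMod L) (Torus.proj L x) =
      Torus.proj L (Function.update x i (2 * n - x i)) := by
  funext j
  simp only [reflectThroughSites_apply, Torus.proj_apply, Function.update_apply]
  by_cases hj : j = i
  · subst hj
    simp only [if_true]
    push_cast
    ring
  · simp [hj]

end Torus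

end Literature.Probability.LatticeModels
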